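import Literature.NumberTheory.Rogawski1990.XiArchPinned
import Literature.RepresentationTheory.HarrisKudlaSweet1996.SplittingCharactersCM
import HarnessLib

/-!
# THE ξ-ARCHIMEDEAN DATA OF RECORD for the T5 kit `𝔠₀`: the unitary archimedean type `k₀` of `μω`, Rogawski's sign `sgnInf₀`,
# and the number `N₀` of compact real places

Cell `hodgecm-mathlib`, F0∕P3 «U3-mult», crux H413 (`stmt-HodgeConjecture-24833`), rung 4; F0P3-p01 (g8) on F0P3-plan (g5) RULING (V32)(3)
(row «`PiXi, ρXi, sgnG, N, packInf, sgnInf` — ξ-side data of (14.6.3)» of PLAN.F0P3g4 addendum 2 §2, the ξ-INDEPENDENT and sign parts).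
DEF LANE: three definitions (`archTypeOfRecord`, `sgnInfOfRecord`, `nCompactOfRecord`) + read-back theorems; no instance, no notation, no named
fact, no `sorry`.  Written against the v5 dossier `Cruxes/H413/Lines/F0_T5InnerFormClassification.lean` (commit 94e361441a4b): the kit family of
ED. 4 is built under the binders `L ι H T hT hdef h2 μ μω hμu hμω` (ROAD (i), REF1 R-18) — NO archimedean type `k` is bound there, so the
`k` that Rogawski's parameter `t = (−expAt k ι − 1)/2` needs (★ `ArchSignRecipe.tOfArchType`) is READ OFF `μω` itself:

* §1 `archTypeOfRecord μω` (= `k₀`): the unitary archimedean type of `μω` (`μω_w(z) = (ι_w z/|ι_w z|)^{k_w}`), CANONICAL — it EXISTS for unitary `μω`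
  with `μω|_{𝕀_{L⁺}} = ω_{L/L⁺}` (★ `IsSplittingChar.exists_hasUnitaryArchType` at `m = 1`, [Liu2021, Remark 4.2]) and is UNIQUE (★
  `hasUnitaryArchType_zero_unique`), so `archTypeOfRecord_eq : μω.HasUnitaryArchType k 0 → archTypeOfRecord μω = k` — every consumer that binds
  its own `k` (F0P2's S2♯ ★ `XiArchPinned L ξ μω k`, the head's (C2♯) `∀ k, μω.HasUnitaryArchType k 0 → …`) reads the SAME integer; every
  `k₀ w` is ODD (`odd_archTypeOfRecord`), and the head's `∀ k`-pin is EQUIVALENT to the pin at `k₀` (`forall_hasUnitaryArchType_iff`).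
* §2 Rogawski's parameter under conjugation of the embedding: `tOfArchType k ῑ = −tOfArchType k ι − 1` for odd `k` (`tOfArchType_conjugate`)
  [Rogawski1990, §12.3 p. 174: `(p, q, t) ↦ (−p, −q, −t−1)`].
* §3 `sgnInfOfRecord ι μω ξ` (= `sgnInf₀ ξ`) `:= ξ.rogSignAt (tOfArchType k₀ ι) ι` — Rogawski's LABEL of the non-tempered member
  `πⁿ(ξ_ι) ∈ {J⁺_φ, J⁻_φ}` [§12.3 p. 178, Prop. 12.3.3]: `= ±1` always; `= ξ.qψ ι` (the `ι`-exponent of the `det`-character `ψ`) on the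
  cohomological locus `ξ.IsCohTrivialAt (tOfArchType k ι) ι` (`sgnInfOfRecord_eq_qψ`); flips under `ι ↦ ῑ` (`sgnInfOfRecord_conjugate`).
  DICTIONARY NOTE (not asserted here): the kit's `ArchPacketCoh` ∕ (L6) read `sgnInf ξ` as the TYPE INDEX `δ` of ★ `upqTypeClasses … 1 δ`
  (`δ = a − b` for `H^{a,b}`, ★ `UpqHodgeBigrading`); that `J⁺_φ` carries the class of type `δ = +1` at the frame's `ι` is the composite of three
  conventions (Rogawski's `χ^±_φ`, the tree's `expAt`, the tree's `J` on `𝔭`) and is NOT settled by this file — a global flip would be absorbed by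
  ONE later definition `sgnInf₀′ := −sgnInf₀`; (C3♯) (`∃ sgn`) is insensitive to it.
* §4 `nCompactOfRecord L` (= `N₀ = Card S₀`, [Rogawski1990, §14.6 p. 244 l. 5: «Let `N = Card(S₀)`», `S₀` = the infinite places `v` of `L⁺` with
  `G′_v ≅ U_3(ℝ)`, §14.2 p. 233]) `:= [L⁺ : ℚ] − 1`: at a compact CM frame (`H` of signature `(2,1)` at `ι`, definite at every `τ′` not over `ι`)
  the compact real places are all but the one under `ι`; read back as `Fintype.card {v : InfinitePlace L⁺ // v ≠ (mk ι).comap _}`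
  (`nCompactOfRecord_eq_card_ne`) and as `Fintype.card {w : InfinitePlace L // w ≠ mk ι}` (`nCompactOfRecord_eq_card_ne_infinitePlace`);
  `ξ`-independent (the kit field `N : OneDimAutRepH L → ℕ` is instantiated by the constant function).

`sgnG₀` (the global transfer-factor sign `c = ∏ c_v = ±1`, p. 243 l. 9 – p. 244 l. 4) has NO carrier in the tree (F0P3b-plan (g7) (V32)(3)(a), REF1 R-21): it is
ONE scalar parameter `c` of the ED. 4 closer, not defined here; `packInf₀` waits for ★ `F0P3bArchDegOneClass` (X1′) and is not defined here either.

References: [Rogawski1990] J. Rogawski, *Automorphic Representations of Unitary Groups in Three Variables*, Ann. of Math. Stud. 123 (1990): §4.8 p. 51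
(`μ|_{𝕀_F} = ω_{E/F}`), §12.3 pp. 174–178 (`μ(z) = (z/z̄)^{t+1/2}`, `J^±_φ`, Prop. 12.3.3), §14.2 p. 233 (`S₀`), §14.6 p. 244 (`N = Card(S₀)`, Thm. 14.6.4);
[Liu2021] Y. Liu, *Fourier–Jacobi cycles and arithmetic relative trace formula*, Camb. J. Math. 9 (2021), Remark 4.2; [Patrikis2019] §2.1 (unitary archimedean parameters).
HC_CM is proved only modulo the printed citations until rung 0 closes.
-/

set_option autoImplicit false
set_option linter.dupNamespace false

noncomputable section

open NumberField
open scoped Classical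

namespace Summit.HodgeConjecture.HodgeConjecture.Cruxes.H413.F0P3XiArchDataOfRecord

open Literature.NumberTheory.Rogawski1990 Literature.NumberTheory.GaloisRepresentations Literature.NumberTheory.Automorphic
open Literature.RepresentationTheory.HarrisKudlaSweet1996 (IsSplittingChar hasUnitaryArchType_zero_unique)

variable {L : Type} [Field L] [NumberField L] [IsCMField L]

/-! ## §1 The unitary archimedean type of record `k₀ = archTypeOfRecord μω` -/

/-- `μω|_{𝕀_{L⁺}} = ω_{L/L⁺}` (the frame hypothesis `hμω` of ★ `KitFamily`, §4.8 p. 51) says `μω` is a splitting character for `m = 1`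
(★ `IsSplittingChar L 1 μω`). [cite: Rogawski1990, §4.8 p. 51] -/
theorem isSplittingChar_one_of_restrict (μω : HeckeCharacter L)
    (hμω : ∀ x : ideleGroup ↥(maximalRealSubfield L),
      μω (AdeleRing.ideleBaseChange (↥(maximalRealSubfield L)) L x) = quadraticHeckeCharCM L x) :
    IsSplittingChar L 1 μω := fun x => by
  rw [pow_one]
  exact hμω x

/-- **`μω` has an ODD unitary archimedean type** `(k, 0)`: `μω_w(z) = (ι_w z/|ι_w z|)^{k_w}`, `k_w ≡ 1 (mod 2)` (★ `IsSplittingChar.exists_hasUnitaryArchType`,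
[Liu2021, Remark 4.2], for unitary `μω` with `μω|_{𝕀_{L⁺}} = ω_{L/L⁺}`). [cite: Liu2021, Remark 4.2] -/
theorem exists_hasUnitaryArchType_odd (μω : HeckeCharacter L) (hμu : μω.IsUnitary)
    (hμω : ∀ x : ideleGroup ↥(maximalRealSubfield L),
      μω (AdeleRing.ideleBaseChange (↥(maximalRealSubfield L)) L x) = quadraticHeckeCharCM L x) :
    ∃ k : InfinitePlace L → ℤ, μω.HasUnitaryArchType k (fun _ => 0) ∧ ∀ w, Odd (k w) := by
  obtain ⟨k, hk, hmod⟩ := (isSplittingChar_one_of_restrict μω hμω).exists_hasUnitaryArchType hμu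
  refine ⟨k, hk, fun w => ?_⟩
  have h := hmod w
  rw [Int.odd_iff]
  have := Int.emod_emod_of_dvd (k w) (dvd_refl (2 : ℤ))
  simpa [Int.ModEq] using h

/-- **The unitary archimedean type `(k, 0)` of `μω` is unique** (★ `hasUnitaryArchType_zero_unique`). [cite: Liu2021, Remark 4.2] -/
theorem hasUnitaryArchType_unique {μω : HeckeCharacter L} (hμu : μω.IsUnitary) {k k' : InfinitePlace L → ℤ}
    (hk : μω.HasUnitaryArchType k (fun _ => 0)) (hk' : μω.HasUnitaryArchType k' (fun _ => 0)) : k = k' :=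
  hasUnitaryArchType_zero_unique hμu hk hk'

/-- **`k₀ = archTypeOfRecord μω` — THE UNITARY ARCHIMEDEAN TYPE OF RECORD of `μω`** (`μω_w(z) = (ι_w z/|ι_w z|)^{k₀ w}`): a choice of a
function `k` with `μω.HasUnitaryArchType k 0` when one exists (Hilbert `ε`); canonical by `archTypeOfRecord_eq`.  Rogawski: `μ_ι(z) = (z/z̄)^{t+1/2}`,
`2t + 1 = −expAt k₀ ι`. [cite: Rogawski1990, §12.3 p. 174] -/
def archTypeOfRecord (μω : HeckeCharacter L) : InfinitePlace L → ℤ :=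
  Classical.epsilon fun k : InfinitePlace L → ℤ => μω.HasUnitaryArchType k (fun _ => 0)

/-- `μω` HAS the type of record (at the letters' frames: `μω` unitary with `μω|_{𝕀_{L⁺}} = ω_{L/L⁺}`). [cite: Liu2021, Remark 4.2] -/
theorem hasUnitaryArchType_archTypeOfRecord (μω : HeckeCharacter L) (hμu : μω.IsUnitary)
    (hμω : ∀ x : ideleGroup ↥(maximalRealSubfield L),
      μω (AdeleRing.ideleBaseChange (↥(maximalRealSubfield L)) L x) = quadraticHeckeCharCM L x) :
    μω.HasUnitaryArchType (archTypeOfRecord μω) (fun _ => 0) := by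
  obtain ⟨k, hk, -⟩ := exists_hasUnitaryArchType_odd μω hμu hμω
  exact Classical.epsilon_spec (p := fun k : InfinitePlace L → ℤ => μω.HasUnitaryArchType k (fun _ => 0)) ⟨k, hk⟩

/-- **EVERY-WITNESS-SAFE**: any unitary archimedean type `(k, 0)` of a unitary `μω` IS the type of record — the `k` bound by F0P2's S2♯
(★ `XiArchPinned L ξ μω k`) and by the T5 head's (C2♯) `∀ k, μω.HasUnitaryArchType k 0 → …` is `archTypeOfRecord μω`. [cite: Liu2021, Remark 4.2] -/
theorem archTypeOfRecord_eq {μω : HeckeCharacter L} (hμu : μω.IsUnitary) {k : InfinitePlace L → ℤ}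
    (hk : μω.HasUnitaryArchType k (fun _ => 0)) : archTypeOfRecord μω = k :=
  hasUnitaryArchType_unique hμu
    (Classical.epsilon_spec (p := fun k : InfinitePlace L → ℤ => μω.HasUnitaryArchType k (fun _ => 0)) ⟨k, hk⟩) hk

/-- Every `k₀ w` is ODD (`μω|_{ℝ^×} = sgn` at each real place of `L⁺`). [cite: Liu2021, Remark 4.2] -/
theorem odd_archTypeOfRecord (μω : HeckeCharacter L) (hμu : μω.IsUnitary)
    (hμω : ∀ x : ideleGroup ↥(maximalRealSubfield L),
      μω (AdeleRing.ideleBaseChange (↥(maximalRealSubfield L)) L x) = quadraticHeckeCharCM L x)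
    (w : InfinitePlace L) : Odd (archTypeOfRecord μω w) := by
  obtain ⟨k, hk, hodd⟩ := exists_hasUnitaryArchType_odd μω hμu hμω
  rw [archTypeOfRecord_eq hμu hk]
  exact hodd w

/-- **The head's `∀ k`-pin is the pin at `k₀`**: for unitary `μω` with `μω|_{𝕀_{L⁺}} = ω_{L/L⁺}` and any predicate `P` on types,
`(∀ k, μω.HasUnitaryArchType k 0 → P k) ↔ P (archTypeOfRecord μω)` — the (C2♯)∕(C3♯) conjunct
`∀ k, μω.HasUnitaryArchType k 0 → ∀ ι′, ξ.IsCohTrivialAt (tOfArchType k ι′) ι′` of ★ `shapeGuarded_of_T5` is ONE condition at `k₀`. [cite: Liu2021, Remark 4.2] -/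
theorem forall_hasUnitaryArchType_iff (μω : HeckeCharacter L) (hμu : μω.IsUnitary)
    (hμω : ∀ x : ideleGroup ↥(maximalRealSubfield L),
      μω (AdeleRing.ideleBaseChange (↥(maximalRealSubfield L)) L x) = quadraticHeckeCharCM L x)
    (P : (InfinitePlace L → ℤ) → Prop) :
    (∀ k : InfinitePlace L → ℤ, μω.HasUnitaryArchType k (fun _ => 0) → P k) ↔ P (archTypeOfRecord μω) :=
  ⟨fun h => h _ (hasUnitaryArchType_archTypeOfRecord μω hμu hμω), fun h k hk => by rwa [archTypeOfRecord_eq hμu hk] at h⟩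

/-- **F0P2's currency at `k₀`**: `XiArchPinned L ξ μω k₀ ↔ ∀ ι, ξ.IsCohTrivialAt (tOfArchType k₀ ι) ι` (the first two conjuncts of ★ `XiArchPinned` hold
for the type of record). [cite: Rogawski1990, Prop. 15.2.1 (b) p. 249] -/
theorem xiArchPinned_archTypeOfRecord_iff (ξ : OneDimAutRepH L) (μω : HeckeCharacter L) (hμu : μω.IsUnitary)
    (hμω : ∀ x : ideleGroup ↥(maximalRealSubfield L),
      μω (AdeleRing.ideleBaseChange (↥(maximalRealSubfield L)) L x) = quadraticHeckeCharCM L x) :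
    XiArchPinned L ξ μω (archTypeOfRecord μω) ↔
      ∀ ι : L →+* ℂ, ξ.IsCohTrivialAt (ArchSignRecipe.tOfArchType (archTypeOfRecord μω) ι) ι :=
  ⟨fun h => h.2.2, fun h => ⟨hasUnitaryArchType_archTypeOfRecord μω hμu hμω, odd_archTypeOfRecord μω hμu hμω, h⟩⟩

/-- Conversely a pin at ANY `k` is the pin at `k₀` (`k = k₀`). [cite: Rogawski1990, Prop. 15.2.1 (b) p. 249] -/
theorem xiArchPinned_iff_eq_and (ξ : OneDimAutRepH L) (μω : HeckeCharacter L) (hμu : μω.IsUnitary) (k : InfinitePlace L → ℤ) :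
    XiArchPinned L ξ μω k ↔
      μω.HasUnitaryArchType k (fun _ => 0) ∧ k = archTypeOfRecord μω ∧ (∀ w, Odd (k w)) ∧
        ∀ ι : L →+* ℂ, ξ.IsCohTrivialAt (ArchSignRecipe.tOfArchType k ι) ι :=
  ⟨fun h => ⟨h.1, (archTypeOfRecord_eq hμu h.1).symm, h.2.1, h.2.2⟩, fun h => ⟨h.1, h.2.2.1, h.2.2.2⟩⟩

/-! ## §2 Rogawski's parameter `t` under conjugation of the embedding -/

omit [NumberField L] [IsCMField L] in
/-- `expAt k ι` is odd when every `k w` is. [cite: Rogawski1990, §12.3 p. 174] -/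
theorem odd_expAt (k : InfinitePlace L → ℤ) (hk : ∀ w, Odd (k w)) (ι : L →+* ℂ) : Odd (OneDimAutRepH.expAt k ι) := by
  unfold OneDimAutRepH.expAt
  split_ifs <;> simp [hk]

/-- **`t ↦ −t − 1` under `ι ↦ ῑ`**: `tOfArchType k ῑ = −tOfArchType k ι − 1` for odd `k` (`expAt k ῑ = −expAt k ι`, ★ `expAt_conjugate`; exact halving since
`expAt k ι` is odd) — «the conjugate identification `E_v = ℂ` replaces `(p, q, t)` by `(−p, −q, −t−1)`». [cite: Rogawski1990, §12.3 p. 174] -/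
theorem tOfArchType_conjugate (k : InfinitePlace L → ℤ) (hk : ∀ w, Odd (k w)) (ι : L →+* ℂ) :
    ArchSignRecipe.tOfArchType k (ComplexEmbedding.conjugate ι) = -ArchSignRecipe.tOfArchType k ι - 1 := by
  obtain ⟨m, hm⟩ := odd_expAt k hk ι
  unfold ArchSignRecipe.tOfArchType
  rw [OneDimAutRepH.expAt_conjugate, hm]
  omega

/-- The cohomological-weight condition at `ῑ` is the one at `ι` (for odd `k`; ★ `isCohTrivialAt_conjugate` + `tOfArchType_conjugate`).
[cite: Rogawski1990, §12.3 p. 178] -/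
theorem isCohTrivialAt_tOfArchType_conjugate (ξ : OneDimAutRepH L) (k : InfinitePlace L → ℤ) (hk : ∀ w, Odd (k w)) (ι : L →+* ℂ)
    (h : ξ.IsCohTrivialAt (ArchSignRecipe.tOfArchType k ι) ι) :
    ξ.IsCohTrivialAt (ArchSignRecipe.tOfArchType k (ComplexEmbedding.conjugate ι)) (ComplexEmbedding.conjugate ι) := by
  rw [tOfArchType_conjugate k hk ι]
  exact ξ.isCohTrivialAt_conjugate h

/-- **The pin at ONE embedding over each place is the pin at every embedding** (odd `k`): `ι′` with `mk ι′ = mk ι` is `ι` or `ῑ`.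
[cite: Rogawski1990, §12.3 p. 178] -/
theorem isCohTrivialAt_of_mk_eq (ξ : OneDimAutRepH L) (k : InfinitePlace L → ℤ) (hk : ∀ w, Odd (k w)) (ι : L →+* ℂ)
    (h : ξ.IsCohTrivialAt (ArchSignRecipe.tOfArchType k ι) ι) (ι' : L →+* ℂ) (hι' : InfinitePlace.mk ι' = InfinitePlace.mk ι) :
    ξ.IsCohTrivialAt (ArchSignRecipe.tOfArchType k ι') ι' := by
  rcases InfinitePlace.mk_eq_iff.1 hι' with h1 | h1
  · rw [h1]; exact h
  · have h2 : ι' = ComplexEmbedding.conjugate ι := by rw [← h1, ComplexEmbedding.involutive_conjugate L ι']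
    rw [h2]; exact isCohTrivialAt_tOfArchType_conjugate ξ k hk ι h

/-! ## §3 `sgnInf₀ = sgnInfOfRecord ι μω` — Rogawski's label of `πⁿ(ξ_ι)` at the type of record -/

/-- **`sgnInf₀ ξ := ξ.rogSignAt (tOfArchType k₀ ι) ι`** — Rogawski's LABEL of the non-tempered member of `Π(ξ_ι)`: `+1` if `πⁿ(ξ_ι) = J⁺_φ`
(`ξ_ι = ξ(b,a,c)`, `n = b − c = 1`), `−1` if `πⁿ(ξ_ι) = J⁻_φ` (`ξ_ι = ξ(a,c,b)`), w.r.t. the parameter `t` of `μω` at `ι` read off the type of record `k₀`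
(★ `OneDimAutRepH.rogSignAt`, ★ `ArchSignRecipe.tOfArchType`).  The kit field `sgnInf : OneDimAutRepH L → ℤ` of `𝔠₀`.
[cite: Rogawski1990, §12.3 p. 178, Prop. 12.3.3] -/
def sgnInfOfRecord (ι : L →+* ℂ) (μω : HeckeCharacter L) (ξ : OneDimAutRepH L) : ℤ :=
  ξ.rogSignAt (ArchSignRecipe.tOfArchType (archTypeOfRecord μω) ι) ι

/-- Unfolding. [cite: Rogawski1990, §12.3 p. 178] -/
theorem sgnInfOfRecord_def (ι : L →+* ℂ) (μω : HeckeCharacter L) (ξ : OneDimAutRepH L) :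
    sgnInfOfRecord ι μω ξ = ξ.rogSignAt (ArchSignRecipe.tOfArchType (archTypeOfRecord μω) ι) ι :=
  rfl

/-- **EVERY-WITNESS-SAFE**: at any unitary type `(k, 0)` of a unitary `μω`, `sgnInf₀ ξ = ξ.rogSignAt (tOfArchType k ι) ι`. [cite: Rogawski1990, §12.3 p. 178] -/
theorem sgnInfOfRecord_eq_rogSignAt (ι : L →+* ℂ) {μω : HeckeCharacter L} (hμu : μω.IsUnitary) {k : InfinitePlace L → ℤ}
    (hk : μω.HasUnitaryArchType k (fun _ => 0)) (ξ : OneDimAutRepH L) :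
    sgnInfOfRecord ι μω ξ = ξ.rogSignAt (ArchSignRecipe.tOfArchType k ι) ι := by
  rw [sgnInfOfRecord_def, archTypeOfRecord_eq hμu hk]

/-- `sgnInf₀ ξ = ±1` — unconditionally (the kit's `(δ = 1 ∨ δ = -1)` side conditions at `δ = sgnInf₀ ξ`). [cite: Rogawski1990, §12.3 p. 178] -/
theorem sgnInfOfRecord_eq_one_or_eq_neg_one (ι : L →+* ℂ) (μω : HeckeCharacter L) (ξ : OneDimAutRepH L) :
    sgnInfOfRecord ι μω ξ = 1 ∨ sgnInfOfRecord ι μω ξ = -1 :=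
  ξ.rogSignAt_eq_one_or_eq_neg_one _ _

/-- **On the cohomological locus the sign is `q = ξ.qψ ι`** (the `ι`-exponent of the `det`-character `ψ`), independent of `η` and `μω`:
under `ξ.IsCohTrivialAt (tOfArchType k ι) ι` for a unitary type `(k,0)` of `μω`, `sgnInf₀ ξ = ξ.qψ ι` (★ `rogSignAt_eq_qψ`).
[cite: Rogawski1990, §12.3 p. 178; Prop. 15.2.1 (b) p. 249] -/
theorem sgnInfOfRecord_eq_qψ (ι : L →+* ℂ) {μω : HeckeCharacter L} (hμu : μω.IsUnitary) {k : InfinitePlace L → ℤ}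
    (hk : μω.HasUnitaryArchType k (fun _ => 0)) (ξ : OneDimAutRepH L) (h : ξ.IsCohTrivialAt (ArchSignRecipe.tOfArchType k ι) ι) :
    sgnInfOfRecord ι μω ξ = ξ.qψ ι := by
  rw [sgnInfOfRecord_eq_rogSignAt ι hμu hk]
  exact ξ.rogSignAt_eq_qψ h

/-- The same at the type of record: `ξ.IsCohTrivialAt (tOfArchType k₀ ι) ι → sgnInf₀ ξ = ξ.qψ ι`. [cite: Rogawski1990, §12.3 p. 178] -/
theorem sgnInfOfRecord_eq_qψ_of_isCohTrivialAt (ι : L →+* ℂ) (μω : HeckeCharacter L) (ξ : OneDimAutRepH L)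
    (h : ξ.IsCohTrivialAt (ArchSignRecipe.tOfArchType (archTypeOfRecord μω) ι) ι) :
    sgnInfOfRecord ι μω ξ = ξ.qψ ι :=
  ξ.rogSignAt_eq_qψ h

/-- **The label FLIPS under conjugation of the embedding** (`J⁺_φ ↔ J⁻_φ` when `L_w = ℂ` is read through `ῑ`): for unitary `μω` with
`μω|_{𝕀_{L⁺}} = ω_{L/L⁺}`, `sgnInf` at `ῑ` is `−sgnInf` at `ι` (★ `rogSignAt_conjugate` + `tOfArchType_conjugate`). [cite: Rogawski1990, §12.3 p. 178] -/
theorem sgnInfOfRecord_conjugate (ι : L →+* ℂ) (μω : HeckeCharacter L) (hμu : μω.IsUnitary)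
    (hμω : ∀ x : ideleGroup ↥(maximalRealSubfield L),
      μω (AdeleRing.ideleBaseChange (↥(maximalRealSubfield L)) L x) = quadraticHeckeCharCM L x)
    (ξ : OneDimAutRepH L) :
    sgnInfOfRecord (ComplexEmbedding.conjugate ι) μω ξ = -sgnInfOfRecord ι μω ξ := by
  rw [sgnInfOfRecord_def, sgnInfOfRecord_def, tOfArchType_conjugate _ (odd_archTypeOfRecord μω hμu hμω)]
  exact ξ.rogSignAt_conjugate _ _

/-- On the cohomological locus, embeddings over the same place with the same sign are equal: if `ξ_ι` is of cohomological type then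
`sgnInf` at `ι′` over `ι` equals `sgnInf` at `ι` iff `ι′ = ι` (the conjugate flips it and `±1 ≠ ∓1`). [cite: Rogawski1990, §12.3 p. 178] -/
theorem sgnInfOfRecord_eq_iff_eq_of_mk_eq (ι ι' : L →+* ℂ) (hι' : InfinitePlace.mk ι' = InfinitePlace.mk ι) (μω : HeckeCharacter L)
    (hμu : μω.IsUnitary)
    (hμω : ∀ x : ideleGroup ↥(maximalRealSubfield L),
      μω (AdeleRing.ideleBaseChange (↥(maximalRealSubfield L)) L x) = quadraticHeckeCharCM L x)
    (ξ : OneDimAutRepH L) : sgnInfOfRecord ι' μω ξ = sgnInfOfRecord ι μω ξ ↔ ι' = ι := by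
  refine ⟨fun h => ?_, fun h => by rw [h]⟩
  rcases InfinitePlace.mk_eq_iff.1 hι' with h1 | h1
  · exact h1
  · have h2 : ι' = ComplexEmbedding.conjugate ι := by rw [← h1, ComplexEmbedding.involutive_conjugate L ι']
    rw [h2, sgnInfOfRecord_conjugate ι μω hμu hμω ξ] at h
    rcases sgnInfOfRecord_eq_one_or_eq_neg_one ι μω ξ with h3 | h3 <;> rw [h3] at h <;> norm_num at h

/-! ## §4 `N₀ = nCompactOfRecord L` — the number of COMPACT real places of a compact CM frame -/

/-- **`N₀ := [L⁺ : ℚ] − 1`** = `Card(S₀)`, `S₀` = the real places `v` of `L⁺` with `G′_v ≅ U_3(ℝ)`: at a compact CM frame (`H` of signature `(2,1)` at the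
place under `ι`, `hT`; positive definite at every embedding not over `ι`, `hdef`) these are ALL real places of the totally real `L⁺` but the one under `ι`.
The kit field `N : OneDimAutRepH L → ℕ` of `𝔠₀` is the constant `N₀` (the sign `(−1)^N` of (14.6.3)). «Let `N = Card(S₀)`.»
[cite: Rogawski1990, §14.6 p. 244, Thm. 14.6.4; §14.2 p. 233] -/
def nCompactOfRecord (L : Type) [Field L] [NumberField L] [IsCMField L] : ℕ :=
  Module.finrank ℚ ↥(maximalRealSubfield L) - 1

/-- Unfolding. [cite: Rogawski1990, §14.6 p. 244] -/
theorem nCompactOfRecord_def (L : Type) [Field L] [NumberField L] [IsCMField L] :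
    nCompactOfRecord L = Module.finrank ℚ ↥(maximalRealSubfield L) - 1 :=
  rfl

/-- `L⁺` is totally real: `#(InfinitePlace L⁺) = [L⁺ : ℚ]`. [folklore] -/
theorem card_infinitePlace_maximalRealSubfield (L : Type) [Field L] [NumberField L] [IsCMField L] :
    Fintype.card (InfinitePlace ↥(maximalRealSubfield L)) = Module.finrank ℚ ↥(maximalRealSubfield L) := by
  rw [InfinitePlace.card_eq_nrRealPlaces_add_nrComplexPlaces, IsTotallyReal.nrComplexPlaces_eq_zero, add_zero, ← IsTotallyReal.finrank]

/-- `#(InfinitePlace L) = [L⁺ : ℚ]` (★ Mathlib `IsCMField.card_infinitePlace_eq_card_infinitePlace`). [folklore] -/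
theorem card_infinitePlace_eq_finrank_maximalRealSubfield (L : Type) [Field L] [NumberField L] [IsCMField L] :
    Fintype.card (InfinitePlace L) = Module.finrank ℚ ↥(maximalRealSubfield L) := by
  rw [← IsCMField.card_infinitePlace_eq_card_infinitePlace, card_infinitePlace_maximalRealSubfield]

/-- `N₀ + 1 = [L⁺ : ℚ]`. [cite: Rogawski1990, §14.6 p. 244] -/
theorem nCompactOfRecord_add_one (L : Type) [Field L] [NumberField L] [IsCMField L] :
    nCompactOfRecord L + 1 = Module.finrank ℚ ↥(maximalRealSubfield L) := by
  have h : 1 ≤ Module.finrank ℚ ↥(maximalRealSubfield L) := Module.finrank_pos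
  unfold nCompactOfRecord
  omega

/-- At the letters' frames (`h2 : 2 ≤ [L⁺ : ℚ]`): `1 ≤ N₀` — there IS a compact real place. [cite: Rogawski1990, §14.6 p. 244] -/
theorem one_le_nCompactOfRecord (L : Type) [Field L] [NumberField L] [IsCMField L] (h2 : 2 ≤ Module.finrank ℚ ↥(maximalRealSubfield L)) :
    1 ≤ nCompactOfRecord L := by
  unfold nCompactOfRecord
  omega

/-- **READ-BACK: `N₀ = Card(S₀)` as real places of `L⁺`** — the number of real places of `L⁺` other than the one under `ι`.
[cite: Rogawski1990, §14.6 p. 244; §14.2 p. 233] -/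
theorem nCompactOfRecord_eq_card_ne (L : Type) [Field L] [NumberField L] [IsCMField L] (ι : L →+* ℂ) :
    nCompactOfRecord L =
      Fintype.card {v : InfinitePlace ↥(maximalRealSubfield L) //
        v ≠ (InfinitePlace.mk ι).comap (algebraMap ↥(maximalRealSubfield L) L)} := by
  rw [Fintype.card_subtype_compl, Fintype.card_subtype_eq, card_infinitePlace_maximalRealSubfield, nCompactOfRecord_def]

/-- **READ-BACK: `N₀` as infinite places of `L`** — the number of (complex) places of `L` other than `mk ι` (the frame hypothesis `hdef` ranges over the
embeddings `τ′` with `mk τ′ ≠ mk ι`, two per such place). [cite: Rogawski1990, §14.6 p. 244] -/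
theorem nCompactOfRecord_eq_card_ne_infinitePlace (L : Type) [Field L] [NumberField L] [IsCMField L] (ι : L →+* ℂ) :
    nCompactOfRecord L = Fintype.card {w : InfinitePlace L // w ≠ InfinitePlace.mk ι} := by
  rw [Fintype.card_subtype_compl, Fintype.card_subtype_eq, card_infinitePlace_eq_finrank_maximalRealSubfield, nCompactOfRecord_def]

/-- **READ-BACK in embeddings**: twice `N₀` is the number of complex embeddings `τ′` of `L` NOT over `ι` — the index set of the frame hypothesis
`hdef : ∀ τ′, mk τ′ ≠ mk ι → (H.map τ′).PosDef`. [cite: Rogawski1990, §14.6 p. 244] -/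
theorem two_mul_nCompactOfRecord_eq_card_embeddings (L : Type) [Field L] [NumberField L] [IsCMField L] (ι : L →+* ℂ) :
    2 * nCompactOfRecord L = Fintype.card {τ' : L →+* ℂ // InfinitePlace.mk τ' ≠ InfinitePlace.mk ι} := by
  classical
  -- embeddings not over `ι` = all embeddings minus the two over `mk ι` (a complex place)
  have hι : (InfinitePlace.mk ι).IsComplex := IsTotallyComplex.isComplex _
  have hfib : Fintype.card {τ' : L →+* ℂ // InfinitePlace.mk τ' = InfinitePlace.mk ι} = 2 := by
    rw [Fintype.card_subtype, InfinitePlace.card_filter_mk_eq, InfinitePlace.mult, if_neg (InfinitePlace.not_isReal_iff_isComplex.2 hι)]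
  have htot : Fintype.card (L →+* ℂ) = 2 * Module.finrank ℚ ↥(maximalRealSubfield L) := by
    rw [Embeddings.card, ← Module.finrank_mul_finrank ℚ ↥(maximalRealSubfield L) L, Algebra.IsQuadraticExtension.finrank_eq_two _ L, mul_comm]
  rw [Fintype.card_subtype_compl, hfib, htot, nCompactOfRecord_def]
  have h : 1 ≤ Module.finrank ℚ ↥(maximalRealSubfield L) := Module.finrank_pos
  omega

end Summit.HodgeConjecture.HodgeConjecture.Cruxes.H413.F0P3XiArchDataOfRecord

end
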